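/-
Copyright (c) 2026 the pub-hodgecm-mathlib formalisation cell (harness21).  Prover seat hodgecm-mathlib-F0P2-p08 (g3), Track B «K2-LIT»,
#184♮ = hLiu418 = `stmt-HodgeConjecture-24832`; socket #41 `sig_K2LiuSiegelEisensteinContinuation`, KIND W, brick (KW-J): THE `hJ` PAYER AT `n = 2`
(LEAD F0P6-plan (g14) BATCH #137 (2); KW desk K2E4-p10 (g9)).  THEOREMS ONLY (no `def`, no `instance`, no notation, no named-fact hypothesis, no `sorry`).
-/
import Summits.HodgeConjecture.HodgeConjecture.Theorems.K2LiuGoodPlaceLocalFactorIntegrable   -- ★ glue `integral_unipDeltaLoc_lambdaLoc_eq_of_one_lt_re` (⊇ ★ B4, ★ B2, ★ B1, ★ `isSphericalSection_lambdaLoc`)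
import Summits.HodgeConjecture.HodgeConjecture.Theorems.K2LiuSiegelEisensteinKindWLetters      -- ★ (x-a) ED. 1–2: `kindWPlaces` + the off-`U(S,h)` letters
import Summits.HodgeConjecture.HodgeConjecture.Theorems.K2LiuTateCharacterLocalTrace           -- ★ B3: Tate's local trace letters `τ`, `hΨ`
import Literature.NumberTheory.GelbartRogawski1991.LocalDoubledUnitaryGoodPlace                -- ★ `IsGoodPlace` (+ `eventually_isGoodPlace`), `valuation_eq_one_iff_valued`
import Literature.NumberTheory.Automorphic.Liu2021.LemD1AsPrintedIndexedNonVacuityInertCofinite -- ★ `valued_toPlace_of_isUnramifiedIn`, `valued_toPlace_uniformizer_of_isUnramifiedIn`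
import Literature.NumberTheory.Automorphic.SymplecticCartanIwasawaUniqueness                   -- ★ `v_inv_apply_le_one_of_v_det_eq_one` (integral matrix, unit determinant ⇒ integral inverse)
import Literature.NumberTheory.Automorphic.SiegelReducedFamiliesCutoff                         -- ★ `map_nonsing_inv_of_isUnit_det`
import Literature.NumberTheory.Automorphic.ValuedFieldValuativeRelBridge                       -- ★ `v_le_iff_valuation_le`
import HarnessLib

/-!
# Crux `HLiu418`, socket #41, KIND W — brick (KW-J) `K2LiuKindWGoodPlaceFactor`: THE RANK-TWO PER-PLACE LETTER `hJ` OF ★ `kindW_block_of_record`, PAID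
# `∫_{N_Δ(L⁺_v)} conj ψ_S(ι_v y) · Λ_{s,v}((w_Δ)_v y) dν_v(y) = (1 − q_v^{−(2s+1)}) · (1 − ε(ϖ_v) q_v^{−(2s+2)})`  off `U(S,h)`, modulo the good-place kit

Cell `hodgecm-mathlib`, crux item hLiu418 = `stmt-HodgeConjecture-24832` (helper lane `--supports … --as helper`, count-neutral), route of record
`HCCMUnconditional`; squad K2 ∕ K2Liu, road `K2_Liu`, socket #41, KIND W.  THE LETTER PAID: the binder `hJ` of ★ p862959
`K2LiuSiegelEisensteinKindWOfRecord.kindW_block_of_record` (:149–158) = of ★ (x-a) ED. 3∕4 `exists_kindW_eulerLetters_of_(local)letters` — for every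
non-singular skew index `S`, every `h`, every `s` with `n∕2 < re s` and every finite place `v ∉ U(S,h) = kindWPlaces ↑T₀ ↑S h`:
`∫ conj ψ_S(ι_v y) · Λ_{s,v}(evalPlace v (finPart w_Δ) · y) ∂(νv v) = (1 − q_v^{−(2s+1)})(1 − ε(ϖ_v) q_v^{−(2s+2)})` (`ε = quadraticHeckeCharCM L`).  This is the `n = 2`
twin of ★ p862965 §3 (`K2LiuKindOneLineGoodPlaceFactor`, the `hJ₁` payer): the ★ per-place glue
`K2LiuGoodPlaceLocalFactorIntegrable.integral_unipDeltaLoc_lambdaLoc_eq_of_one_lt_re` (★ B4 ∘ ★ file E7 ∘ ★ B2, integrability paid on `1 < re s`) carries ~30 frame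
letters at the place `v`; here they are DISCHARGED uniformly in `v ∉ U(S,h)`, down to the GOOD-PLACE KIT of ★ `IsGoodPlace` ([GelbartRogawski1991, §3.1 (3.1.3)];
cofinitely true BY NAME: ★ `eventually_isGoodPlace`), the unramifiedness `hunr` of `v` in `L∕L⁺`, and the parity letter `hα` (`∏_{w∣v} χ_w(ι_w ϖ_v) = ε(ϖ_v)`).
* §1 bookkeeping at one place: the volume `ν(N_Δ ∩ K_{H,v}) = 1` from the carrier normalisation `hνK` (`inH = subgroupOf`); the index block `β := −½·(S ⊗ 1)`
  (skew-hermitian from `S ∈ Skew(gramR ⊗ L)`, `β·β⁻¹ = 1` from `det S ≠ 0`, `β`, `β⁻¹` integral above `v` from the off-`U(S,h)` letters ★ (x-a) §1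
  `integral_∕inv_integral_of_not_mem_kindWPlaces` and `|2|_w = 1`); the Gram letters `hTb hTib hTinv` from `IsGoodPlace.gram ∕ .gramDet`
  (★ `v_inv_apply_le_one_of_v_det_eq_one`, ★ `map_nonsing_inv_of_isUnit_det`).
* §2 **`integral_conj_unipDeltaChar_mul_lambdaLoc_weylDelta_eq_of_isGoodPlace`** — the identity at ONE place `v ∉ U(S,h)` from `IsGoodPlace`, `hunr`, `hα`, `χ` unramified
  above `v` and unitary, `1 < re s`: ★ B4 `evalPlace_finPart_weylDelta` + the ★ glue with every frame object CONSTRUCTED (uniformiser ★ `HeckeCharacter.uniformizer`, Skew chart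
  ★ B2 `exists_homeomorph_skew_of_carrier` on ★ `skewMatrices`, `μF := addHaar`, Tate's `ψ_v ∕ Tr` ★ B3, `ε₁ := δ ⊗ 1`, `w₀` ★ `PlacesOver.nonempty`) and §1.
* §3 **`hJ_of_isGoodPlace`** — ★ p862959's binder `hJ` VERBATIM (`n := 2`), from `(T₀) (νv) (hνK) (hχ) (hχu)` and the per-place kit `∀ v ∉ T₀`: `IsGoodPlace …`, `hunr`, `hα`.
[Liu2011, §2A (2-10)] [Shimura1997, §18.1 (18.4)] [KudlaRallis1994, §1] [GelbartRogawski1991, §3.1 (3.1.3)] [Casselman1980, §3].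
HONEST LABEL.  Count-neutral helper; closes no socket by itself: `HC_CM` is proved only modulo the 7 printed citations (2 remaining named inputs:
hLiu418 = `stmt-HodgeConjecture-24832`, h413 = `stmt-HodgeConjecture-24833`) until rung 0 closes.  NOT HERE (by value, per place, cofinitely true): `IsGoodPlace`
(★ `eventually_isGoodPlace`), `hunr`, and the parity `hα` of the TOP's `χ = μ̃`.

## References
* [Liu2011] Y. Liu, *Arithmetic theta lifting and L-derivatives for unitary groups, I*, Algebra Number Theory 5 (2011): §2A p. 936 (2-10).
* [Shimura1997] G. Shimura, *Euler products and Eisenstein series*, CBMS 93 (1997): §18.1 (18.4), §18.3.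
* [KudlaRallis1994] S. Kudla, S. Rallis, Ann. of Math. 140 (1994): §1.   * [Casselman1980] W. Casselman, Compositio Math. 40 (1980): §3.
* [GelbartRogawski1991] S. Gelbart, J. Rogawski, *L-functions and Fourier–Jacobi coefficients for the unitary group U(3)*, Invent. Math. 105 (1991): §3.1 (3.1.3).
* [CasselsFrohlichANT1967] Cassels–Fröhlich (eds.), *Algebraic Number Theory* (1967): Ch. II §11, Ch. XV (Tate) §2.2, §4.1.
-/

set_option autoImplicit false
-- the mandated namespace repeats the single-problem summit's segment (`HodgeConjecture.HodgeConjecture`)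
set_option linter.dupNamespace false

noncomputable section

open scoped Matrix ComplexConjugate NNReal ENNReal
open NumberField IsDedekindDomain Matrix MeasureTheory Measure Set
open Literature.NumberTheory.Automorphic Literature.NumberTheory.Automorphic.UnitaryGroup Literature.NumberTheory.GaloisRepresentations
open Literature.NumberTheory.GaloisRepresentations.IsNonarchimedeanLocalField Literature.NumberTheory.LFunctions
open Literature.NumberTheory.GelbartRogawski1991 Literature.NumberTheory.GelbartRogawski1991.GRConstruction
open Literature.NumberTheory.GelbartRogawski1991.AdaptedBlocks
open Literature.NumberTheory.GelbartRogawski1991.UnitaryDualPair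
open Literature.NumberTheory.K2Lit Literature.NumberTheory.K2Lit.SiegelDoubled Literature.NumberTheory.K2Lit.LocalSiegelDoubled Literature.NumberTheory.K2Lit.PlaceSplitting
open Literature.Topology.Algebra.RestrictedProduct (inH)
open Summit.HodgeConjecture.HodgeConjecture.Cruxes.HLiu418.K2LiuSiegelUnipotentFourierDefs
open Summit.HodgeConjecture.HodgeConjecture.Cruxes.HLiu418.K2LiuSiegelUnipotentLocalDefs
open Summit.HodgeConjecture.HodgeConjecture.Cruxes.HLiu418.K2LiuUnipDeltaLocBridge
open Summit.HodgeConjecture.HodgeConjecture.Cruxes.HLiu418.K2LiuUnipDeltaLocalHaarTransport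
open Summit.HodgeConjecture.HodgeConjecture.Cruxes.HLiu418.K2LiuLocalWhittakerFactorSkew (evalPlace_finPart_weylDelta)
open Summit.HodgeConjecture.HodgeConjecture.Cruxes.HLiu418.K2LiuGoodPlaceLocalFactorIntegrable (integral_unipDeltaLoc_lambdaLoc_eq_of_one_lt_re)
open Summit.HodgeConjecture.HodgeConjecture.Cruxes.HLiu418.K2LiuSiegelEisensteinKindWLetters
open Summit.HodgeConjecture.HodgeConjecture.Cruxes.HLiu418.K2LiuTateCharacterLocalTrace

namespace Summit.HodgeConjecture.HodgeConjecture.Cruxes.HLiu418.K2LiuKindWGoodPlaceFactor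

variable (L : Type) [Field L] [NumberField L] [IsCMField L]
variable {N M : ℕ} (e : Fin N × Fin M ≃ Fin 2)
  (dV : Fin N → L) (hdV : ∀ i, IsCMField.complexConj L (dV i) = dV i)
  (dW : Fin M → L) (hdW : ∀ i, IsCMField.complexConj L (dW i) = dW i)
  (hdV0 : ∀ i, dV i ≠ 0) (hdW0 : ∀ i, dW i ≠ 0)
  (v : HeightOneSpectrum (𝓞 (Fp L)))

/-! ## §1 Bookkeeping at one place: volume, the index block `β = −½·(S ⊗ 1)`, the Gram letters -/

section Volume

variable [MeasurableSpace ↥(unipDeltaLoc L e dV hdV dW hdW v)]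

/-- **`ν(N_Δ(L⁺_v) ∩ K_{H,v}) = 1` from the carrier normalisation `hνK`** of ★ G1 ∕ ★ `kindW_block_of_record` (`inH = subgroupOf`: the carrier of
`inH K_H N_Δ v` is `{u | ↑u ∈ K_{H,v}}`). [folklore] -/
theorem measureReal_setOf_mem_localInt_eq_one (ν : Measure ↥(unipDeltaLoc L e dV hdV dW hdW v))
    (hνK : ν (((inH (fun v => UnitaryGroup.localInt L (IsCMField.complexConj L) (2 + 2) (hermD L e dV hdV dW hdW) v)
      (fun v => unipDeltaLoc L e dV hdV dW hdW v) v) : Subgroup ↥(unipDeltaLoc L e dV hdV dW hdW v)) : Set ↥(unipDeltaLoc L e dV hdV dW hdW v)) = 1) :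
    ν.real {u : ↥(unipDeltaLoc L e dV hdV dW hdW v) | (u : UnitaryGroup.localPi L (IsCMField.complexConj L) (2 + 2) (hermD L e dV hdV dW hdW) v) ∈
      UnitaryGroup.localInt L (IsCMField.complexConj L) (2 + 2) (hermD L e dV hdV dW hdW) v} = 1 := by
  have hset : {u : ↥(unipDeltaLoc L e dV hdV dW hdW v) | (u : UnitaryGroup.localPi L (IsCMField.complexConj L) (2 + 2) (hermD L e dV hdV dW hdW) v) ∈
      UnitaryGroup.localInt L (IsCMField.complexConj L) (2 + 2) (hermD L e dV hdV dW hdW) v} =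
      (((inH (fun v => UnitaryGroup.localInt L (IsCMField.complexConj L) (2 + 2) (hermD L e dV hdV dW hdW) v)
        (fun v => unipDeltaLoc L e dV hdV dW hdW v) v) : Subgroup ↥(unipDeltaLoc L e dV hdV dW hdW v)) : Set ↥(unipDeltaLoc L e dV hdV dW hdW v)) :=
    Set.ext fun u => Iff.rfl
  rw [measureReal_def, hset, hνK, ENNReal.toReal_one]

end Volume

section Beta

variable (S : ↥(skewMatrices ((IsCMField.complexConj L : L ≃ₐ[Fp L] L) : L →+* L) ((gramR L e dV hdV dW hdW).map (algebraMap (Fp L) L))))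

/-- `gramS = (gramR ⊗ L) ⊗_L E_v`: the local Gram matrix is the image of `gramR ⊗ L` under `L → ∏_{w∣v} L_w`. [folklore] -/
theorem gramS_eq_map :
    LocalSplitting.gramS (Fp L) L v 2 (gramR L e dV hdV dW hdW) = ((gramR L e dV hdV dW hdW).map (algebraMap (Fp L) L)).map (algebraMap L (LocalRing L v)) := by
  refine Matrix.ext fun i j => funext fun w => ?_
  simp only [LocalSplitting.gramS, Matrix.map_apply, toLocalRing_apply, Pi.algebraMap_apply]
  exact toPlace_coe v w _

/-- **`β := −½·(S ⊗ 1)` IS `gramS`-SKEW-HERMITIAN** (the glue's letter `hβs`): the skew relation `(gramR⊗L)·S + σ(S)ᵀ·(gramR⊗L) = 0` of `S ∈ Skew` mapped along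
`L → ∏_{w∣v} L_w` (`σ ⊗ 1` on scalars, ★ `conjLocal_algebraMap`) and scaled by the `σ`-fixed scalar `−½`. [cite: Shimura1997, §18.1] -/
theorem beta_skew :
    ((-(⅟(2 : LocalRing L v) • (S : Matrix (Fin 2) (Fin 2) L).map (algebraMap L (LocalRing L v)))).map (conjLocal L (IsCMField.complexConj L) v))ᵀ *
        LocalSplitting.gramS (Fp L) L v 2 (gramR L e dV hdV dW hdW) +
      LocalSplitting.gramS (Fp L) L v 2 (gramR L e dV hdV dW hdW) *
        (-(⅟(2 : LocalRing L v) • (S : Matrix (Fin 2) (Fin 2) L).map (algebraMap L (LocalRing L v)))) = 0 := by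
  set φ : L →+* LocalRing L v := algebraMap L (LocalRing L v) with hφ
  set S' : Matrix (Fin 2) (Fin 2) (LocalRing L v) := (S : Matrix (Fin 2) (Fin 2) L).map φ with hS'
  set G' : Matrix (Fin 2) (Fin 2) (LocalRing L v) := ((gramR L e dV hdV dW hdW).map (algebraMap (Fp L) L)).map φ with hG'
  have hGS : LocalSplitting.gramS (Fp L) L v 2 (gramR L e dV hdV dW hdW) = G' := gramS_eq_map L e dV hdV dW hdW v
  -- the skew relation mapped along `φ`
  have hskew : G' * S' + (S'.map (conjLocal L (IsCMField.complexConj L) v))ᵀ * G' = 0 := by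
    have h0 := (mem_skewMatrices_iff _ _ _).1 S.2
    have h1 := congrArg (RingHom.mapMatrix φ) h0
    rw [map_add, map_mul, map_mul, map_zero, RingHom.mapMatrix_apply, RingHom.mapMatrix_apply, RingHom.mapMatrix_apply] at h1
    have hconj : (((S : Matrix (Fin 2) (Fin 2) L).map ((IsCMField.complexConj L : L ≃ₐ[Fp L] L) : L →+* L))ᵀ).map φ =
        (S'.map (conjLocal L (IsCMField.complexConj L) v))ᵀ := by
      ext i j
      simp only [Matrix.map_apply, Matrix.transpose_apply, hS', RingHom.coe_coe, hφ, conjLocal_algebraMap]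
    rw [hconj] at h1
    exact h1
  -- `σ ⊗ 1` fixes `½`
  have hhalf : conjLocal L (IsCMField.complexConj L) v (⅟(2 : LocalRing L v)) = ⅟(2 : LocalRing L v) := by
    have h2 : conjLocal L (IsCMField.complexConj L) v (⅟(2 : LocalRing L v)) * 2 = 1 := by
      have := congrArg (conjLocal L (IsCMField.complexConj L) v) (invOf_mul_self (2 : LocalRing L v))
      rwa [map_mul, map_ofNat, map_one] at this
    calc conjLocal L (IsCMField.complexConj L) v (⅟(2 : LocalRing L v))
        = conjLocal L (IsCMField.complexConj L) v (⅟(2 : LocalRing L v)) * 2 * ⅟(2 : LocalRing L v) := by rw [mul_assoc, mul_invOf_self, mul_one]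
      _ = ⅟(2 : LocalRing L v) := by rw [h2, one_mul]
  have hmap : (-(⅟(2 : LocalRing L v) • S')).map (conjLocal L (IsCMField.complexConj L) v) = -(⅟(2 : LocalRing L v) • S'.map (conjLocal L (IsCMField.complexConj L) v)) := by
    ext i j
    simp only [Matrix.map_apply, Matrix.neg_apply, Matrix.smul_apply, smul_eq_mul, map_neg, map_mul, hhalf]
  rw [hGS, hmap, Matrix.transpose_neg, Matrix.transpose_smul, Matrix.neg_mul, Matrix.smul_mul, Matrix.mul_neg, Matrix.mul_smul, ← neg_add, ← smul_add,
    add_comm, hskew, smul_zero, neg_zero]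

/-- **`β · β⁻¹ = 1`** with `β⁻¹ := −2·(S⁻¹ ⊗ 1)` (the glue's letter `hββ`), `det S ≠ 0`. [cite: Shimura1997, §18.1] -/
theorem beta_mul_betaInv (hdet : (S : Matrix (Fin 2) (Fin 2) L).det ≠ 0) :
    (-(⅟(2 : LocalRing L v) • (S : Matrix (Fin 2) (Fin 2) L).map (algebraMap L (LocalRing L v)))) *
        (-((2 : LocalRing L v) • (S : Matrix (Fin 2) (Fin 2) L)⁻¹.map (algebraMap L (LocalRing L v)))) = 1 := by
  rw [Matrix.neg_mul, Matrix.mul_neg, neg_neg, Matrix.smul_mul, Matrix.mul_smul, smul_smul, invOf_mul_self, one_smul, ← Matrix.map_mul,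
    Matrix.mul_nonsing_inv _ (Ne.isUnit hdet), Matrix.map_one _ (map_zero _) (map_one _)]

omit [IsCMField L] in
/-- an entry of `S ⊗ 1` above `w ∣ v` is the `w`-adic image of the entry of `S`. [folklore] -/
theorem map_algebraMap_apply (X : Matrix (Fin 2) (Fin 2) L) (i j : Fin 2) (w : UnitaryGroup.PlacesOver L v) :
    (X.map (algebraMap L (LocalRing L v))) i j w = ((X i j : L) : w.1.adicCompletion L) := by
  rw [Matrix.map_apply, Pi.algebraMap_apply]
  rfl

/-- **`β` IS INTEGRAL ABOVE `v`** (the glue's letter `hβ0`): `|β_{ij}|_w ≤ 1 = |ϖ_w|^0` from `S` integral above `v` and `|2|_w = 1`. [cite: Shimura1997, §18.1] -/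
theorem beta_integral {π : v.adicCompletion (Fp L)}
    (h2v : ∀ w : UnitaryGroup.PlacesOver L v, ValuativeRel.valuation (w.1.adicCompletion L) (2 : w.1.adicCompletion L) = 1)
    (hS : ∀ (w : UnitaryGroup.PlacesOver L v) (i j : Fin 2), (((S : Matrix (Fin 2) (Fin 2) L) i j : L) : w.1.adicCompletion L) ∈ w.1.adicCompletionIntegers L)
    (i j : Fin 2) (w : UnitaryGroup.PlacesOver L v) :
    Valued.v ((-(⅟(2 : LocalRing L v) • (S : Matrix (Fin 2) (Fin 2) L).map (algebraMap L (LocalRing L v)))) i j w) ≤ Valued.v (toPlace v w π) ^ (0 : ℤ) := by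
  have h2w : Valued.v ((2 : LocalRing L v) w) = 1 := by
    rw [Pi.ofNat_apply]
    exact (LocalSplitting.valuation_eq_one_iff_valued L w.1 _).1 (h2v w)
  have hhalf : Valued.v ((⅟(2 : LocalRing L v)) w) = 1 := by
    have h := congrArg (fun x : LocalRing L v => Valued.v (x w)) (invOf_mul_self (2 : LocalRing L v))
    simp only [Pi.mul_apply, Pi.one_apply, map_mul, map_one, h2w, mul_one] at h
    exact h
  rw [zpow_zero, Matrix.neg_apply, Pi.neg_apply, Valuation.map_neg, Matrix.smul_apply, smul_eq_mul, Pi.mul_apply, map_mul, hhalf, one_mul,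
    map_algebraMap_apply]
  exact (HeightOneSpectrum.mem_adicCompletionIntegers _ _ _).1 (hS w i j)

/-- **`β⁻¹` IS INTEGRAL ABOVE `v`** (the glue's letter `hβinv0`): `|(β⁻¹)_{ij}|_w ≤ 1` from `S⁻¹` integral above `v` (and `|2|_w ≤ 1`). [cite: Shimura1997, §18.1] -/
theorem betaInv_integral {π : v.adicCompletion (Fp L)}
    (h2v : ∀ w : UnitaryGroup.PlacesOver L v, ValuativeRel.valuation (w.1.adicCompletion L) (2 : w.1.adicCompletion L) = 1)
    (hSinv : ∀ (w : UnitaryGroup.PlacesOver L v) (i j : Fin 2), (((S : Matrix (Fin 2) (Fin 2) L)⁻¹ i j : L) : w.1.adicCompletion L) ∈ w.1.adicCompletionIntegers L)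
    (i j : Fin 2) (w : UnitaryGroup.PlacesOver L v) :
    Valued.v ((-((2 : LocalRing L v) • (S : Matrix (Fin 2) (Fin 2) L)⁻¹.map (algebraMap L (LocalRing L v)))) i j w) ≤ Valued.v (toPlace v w π) ^ (0 : ℤ) := by
  have h2w : Valued.v ((2 : LocalRing L v) w) = 1 := by
    rw [Pi.ofNat_apply]
    exact (LocalSplitting.valuation_eq_one_iff_valued L w.1 _).1 (h2v w)
  rw [zpow_zero, Matrix.neg_apply, Pi.neg_apply, Valuation.map_neg, Matrix.smul_apply, smul_eq_mul, Pi.mul_apply, map_mul, h2w, one_mul,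
    map_algebraMap_apply]
  exact (HeightOneSpectrum.mem_adicCompletionIntegers _ _ _).1 (hSinv w i j)

end Beta

section Gram

variable {χv : ∀ w : UnitaryGroup.PlacesOver L v, (w.1.adicCompletion L)ˣ →* ℂˣ}

/-- the `w`-adic image of `gramR ⊗ L` has integral entries and unit determinant at a good place. [cite: GelbartRogawski1991, §3.1 (3.1.3)] -/
theorem gram_letters (hgood : LocalSplitting.IsGoodPlace (Fp L) L (imagUnit L) v 2 (gramR L e dV hdV dW hdW) χv) (w : UnitaryGroup.PlacesOver L v) :
    (∀ i j, Valued.v ((((gramR L e dV hdV dW hdW).map (algebraMap (Fp L) L)).map (algebraMap L (w.1.adicCompletion L))) i j) ≤ 1) ∧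
      Valued.v (((gramR L e dV hdV dW hdW).map (algebraMap (Fp L) L)).map (algebraMap L (w.1.adicCompletion L))).det = 1 := by
  refine ⟨fun i j => ?_, ?_⟩
  · rw [Matrix.map_apply, Matrix.map_apply]
    have h := hgood.gram w i j
    rw [← map_one (ValuativeRel.valuation (w.1.adicCompletion L)), ← v_le_iff_valuation_le] at h
    rwa [map_one] at h
  · rw [← RingHom.mapMatrix_apply, ← RingHom.map_det, ← RingHom.mapMatrix_apply, ← RingHom.map_det]
    exact (LocalSplitting.valuation_eq_one_iff_valued L w.1 _).1 (hgood.gramDet w)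

include hdV0 hdW0 in
/-- **the glue's letter `hTinv` at a good place**: `gramR⁻¹ ⊗ L` is integral above `v` (integral matrix with unit determinant ⇒ integral inverse,
★ `v_inv_apply_le_one_of_v_det_eq_one`; inverse commutes with scalar extension, ★ `map_nonsing_inv_of_isUnit_det`). [cite: GelbartRogawski1991, §3.1 (3.1.3)] -/
theorem gramR_inv_integral (hgood : LocalSplitting.IsGoodPlace (Fp L) L (imagUnit L) v 2 (gramR L e dV hdV dW hdW) χv) (w : UnitaryGroup.PlacesOver L v) (i j : Fin 2) :
    ValuativeRel.valuation (w.1.adicCompletion L) (algebraMap L (w.1.adicCompletion L) (algebraMap (Fp L) L ((gramR L e dV hdV dW hdW)⁻¹ i j))) ≤ 1 := by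
  obtain ⟨hint, hdet⟩ := gram_letters L e dV hdV dW hdW v hgood w
  have hunit : IsUnit (gramR L e dV hdV dW hdW).det := isUnit_det_gramR₀ L e dV hdV hdV0 dW hdW hdW0
  have hunit' : IsUnit ((gramR L e dV hdV dW hdW).map (algebraMap (Fp L) L)).det := by
    rw [← RingHom.mapMatrix_apply, ← RingHom.map_det]; exact hunit.map _
  have h := SymplecticCartan.v_inv_apply_le_one_of_v_det_eq_one hint hdet i j
  rw [← map_nonsing_inv_of_isUnit_det _ hunit', ← map_nonsing_inv_of_isUnit_det _ hunit, Matrix.map_apply, Matrix.map_apply] at h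
  rw [← map_one (ValuativeRel.valuation (w.1.adicCompletion L)), ← v_le_iff_valuation_le, map_one]
  exact h

include hdV0 hdW0 in
/-- **the glue's letters `hTb`, `hTib` at a good place**: the local Gram matrix `gramS = gramR ⊗ E_v` and its inverse have entries of valuation `≤ 1 = |ϖ_w|^0` above `v`.
[cite: GelbartRogawski1991, §3.1 (3.1.3)] -/
theorem gramS_letters (hgood : LocalSplitting.IsGoodPlace (Fp L) L (imagUnit L) v 2 (gramR L e dV hdV dW hdW) χv) {π : v.adicCompletion (Fp L)} :
    (∀ (i j : Fin 2) (w : UnitaryGroup.PlacesOver L v), Valued.v (LocalSplitting.gramS (Fp L) L v 2 (gramR L e dV hdV dW hdW) i j w) ≤ Valued.v (toPlace v w π) ^ (0 : ℤ)) ∧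
      ∀ (i j : Fin 2) (w : UnitaryGroup.PlacesOver L v), Valued.v ((LocalSplitting.gramS (Fp L) L v 2 (gramR L e dV hdV dW hdW))⁻¹ i j w) ≤ Valued.v (toPlace v w π) ^ (0 : ℤ) := by
  have hunit : IsUnit (gramR L e dV hdV dW hdW).det := isUnit_det_gramR₀ L e dV hdV hdV0 dW hdW hdW0
  have hunit' : IsUnit ((gramR L e dV hdV dW hdW).map (algebraMap (Fp L) L)).det := by
    rw [← RingHom.mapMatrix_apply, ← RingHom.map_det]; exact hunit.map _
  refine ⟨fun i j w => ?_, fun i j w => ?_⟩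
  · rw [zpow_zero, gramS_eq_map, map_algebraMap_apply, Matrix.map_apply]
    have h := hgood.gram w i j
    rw [← map_one (ValuativeRel.valuation (w.1.adicCompletion L)), ← v_le_iff_valuation_le, map_one] at h
    exact h
  · rw [zpow_zero, gramS_eq_map, ← map_nonsing_inv_of_isUnit_det _ hunit', ← map_nonsing_inv_of_isUnit_det _ hunit, map_algebraMap_apply, Matrix.map_apply]
    have h := gramR_inv_integral L e dV hdV dW hdW hdV0 hdW0 v hgood w i j
    rw [← map_one (ValuativeRel.valuation (w.1.adicCompletion L)), ← v_le_iff_valuation_le, map_one] at h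
    exact h

end Gram

/-! ## §2 The identity at one place `v ∉ U(S,h)` from the good-place kit -/

section PerPlace

variable [MeasurableSpace ↥(unipDeltaLoc L e dV hdV dW hdW v)] [BorelSpace ↥(unipDeltaLoc L e dV hdV dW hdW v)]

include hdV0 hdW0 in
set_option maxHeartbeats 400000 in -- MEASURED: 200 000 ✗ (`whnf` of the statement's binder telescope, the ★ glue's class) ∕ 400 000 ✓; scoped 2×, plain `rw`∕`exact`, no search tactics
/-- **THE RANK-TWO GOOD-PLACE LETTER AT ONE PLACE.**  K2Lit CM datum with `e : Fin N × Fin M ≃ Fin 2`; a finite place `v` of `L⁺` that is GOOD (★ `IsGoodPlace` for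
`(L⁺, L, δ = imagUnit L, n = 2, gramR, χ_w = χ.localComponent w)`: `|2|_w = |δ|_w = 1`, `gramR` integral with unit determinant above `v`, `χ_w` unramified, `ψ_{L⁺,v}` of
conductor `𝒪_v`) and unramified in `L` (`hunr`); `χ` unramified above `v` (`hχ`) and unitary (`hχu`); the parity letter `hα : ∏_{w∣v} χ_w(ι_w ϖ_v) = ε(ϖ_v)` at the chosen
uniformiser `ϖ_v` (★ `HeckeCharacter.uniformizer`); a Haar measure `ν` on `N_Δ(L⁺_v) = unipDeltaLoc v` with `ν(N_Δ ∩ K_{H,v}) = 1` (★ G1's `hνK`); a non-singular skew index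
`S` and `h` with `v ∉ U(S,h) = kindWPlaces ↑T₀ ↑S h`; `1 < re s`.  THEN
**`∫ conj ψ_S(ι_v y) · Λ_{s,v}((w_Δ)_v · y) dν(y) = (1 − q_v^{−(2s+1)}) · (1 − ε(ϖ_v) · q_v^{−(2s+2)})`** (`(w_Δ)_v = evalPlace v (finPart w_Δ)` of the GLOBAL Weyl element).
PROOF: ★ B4 `evalPlace_finPart_weylDelta`; ★ glue `integral_unipDeltaLoc_lambdaLoc_eq_of_one_lt_re` with its frame objects constructed — uniformiser, Skew chart (★ `skewMatrices`
+ ★ B2 `exists_homeomorph_skew_of_carrier`, Borel σ-algebra), `μF := addHaar`, Tate's `ψ_v`, `Tr` (★ B3), `ε₁ := δ ⊗ 1`, `w₀` — and the letters of §1 ∕ `IsGoodPlace`; volume §1.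
[cite: Liu2011, §2A (2-10)] [cite: Shimura1997, §18.1 (18.4)] [cite: KudlaRallis1994, §1] [cite: GelbartRogawski1991, §3.1 (3.1.3)] -/
theorem integral_conj_unipDeltaChar_mul_lambdaLoc_weylDelta_eq_of_isGoodPlace
    {χ : HeckeCharacter L} (hχ : ∀ w : UnitaryGroup.PlacesOver L v, χ.IsUnramifiedAt w.1) (hχu : χ.IsUnitary)
    (hgood : LocalSplitting.IsGoodPlace (Fp L) L (imagUnit L) v 2 (gramR L e dV hdV dW hdW) (fun w => χ.localComponent w.1))
    (hunr : Algebra.IsUnramifiedIn (𝓞 L) v.asIdeal)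
    (hα : (((∏ w : UnitaryGroup.PlacesOver L v, χ.localComponent w.1
        (Units.mk0 (toPlace v w (HeckeCharacter.uniformizer (Fp L) v : v.adicCompletion (Fp L)))
          ((map_ne_zero (toPlace v w)).2 (HeckeCharacter.uniformizer (Fp L) v).ne_zero))) : ℂˣ) : ℂ) = (quadraticHeckeCharCM L).valueAtUniformizer v)
    (ν : Measure ↥(unipDeltaLoc L e dV hdV dW hdW v)) [ν.IsHaarMeasure]
    (hνK : ν (((inH (fun v => UnitaryGroup.localInt L (IsCMField.complexConj L) (2 + 2) (hermD L e dV hdV dW hdW) v)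
      (fun v => unipDeltaLoc L e dV hdV dW hdW v) v) : Subgroup ↥(unipDeltaLoc L e dV hdV dW hdW v)) : Set ↥(unipDeltaLoc L e dV hdV dW hdW v)) = 1)
    {T₀ : Set (HeightOneSpectrum (𝓞 (Fp L)))}
    (S : ↥(skewMatrices ((IsCMField.complexConj L : L ≃ₐ[Fp L] L) : L →+* L) ((gramR L e dV hdV dW hdW).map (algebraMap (Fp L) L))))
    (h : HA L e dV hdV dW hdW) (hdet : (S : Matrix (Fin 2) (Fin 2) L).det ≠ 0)
    (hv : v ∉ kindWPlaces L e dV hdV dW hdW T₀ (S : Matrix (Fin 2) (Fin 2) L) h) {s : ℂ} (hs : 1 < s.re) :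
    ∫ y, conj (unipDeltaChar L e dV hdV dW hdW (S : Matrix (Fin 2) (Fin 2) L)
          (locToAdelic L e dV hdV dW hdW v (y : UnitaryGroup.localPi L (IsCMField.complexConj L) (2 + 2) (hermD L e dV hdV dW hdW) v)) : ℂ) *
        LambdaLoc L e dV hdV dW hdW v χ s
          (UnitaryGroup.evalPlace (Fp L) L (IsCMField.complexConj L) (2 + 2) (hermD L e dV hdV dW hdW) v
              (UnitaryGroup.finPart (Fp L) L (IsCMField.complexConj L) (2 + 2) (hermD L e dV hdV dW hdW) (SiegelDoubled.weylDelta L e dV hdV dW hdW)) *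
            (y : UnitaryGroup.localPi L (IsCMField.complexConj L) (2 + 2) (hermD L e dV hdV dW hdW) v)) ∂ν =
      (1 - (v.residueCard : ℂ) ^ (-(2 * s + 1))) * (1 - (quadraticHeckeCharCM L).valueAtUniformizer v * (v.residueCard : ℂ) ^ (-(2 * s + 2))) := by
  haveI : Algebra.IsQuadraticExtension (Fp L) L := IsCMField.isQuadraticExtension L
  -- the uniformiser
  have hπ : Valued.v (HeckeCharacter.uniformizer (Fp L) v : v.adicCompletion (Fp L)) = WithZero.exp (-1 : ℤ) := HeckeCharacter.valued_uniformizer (K := Fp L) v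
  have hπw : ∀ w : UnitaryGroup.PlacesOver L v, Valued.v (toPlace v w (HeckeCharacter.uniformizer (Fp L) v : v.adicCompletion (Fp L))) = WithZero.exp (-1 : ℤ) :=
    fun w => Liu2021.LemD1IndexedNonVacuityInertCofinite.valued_toPlace_uniformizer_of_isUnramifiedIn L v hunr w
  have hϖ0 : ∀ w : UnitaryGroup.PlacesOver L v, toPlace v w (HeckeCharacter.uniformizer (Fp L) v : v.adicCompletion (Fp L)) ≠ 0 :=
    fun w => (map_ne_zero (toPlace v w)).2 (HeckeCharacter.uniformizer (Fp L) v).ne_zero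
  -- the Skew chart (★ `skewMatrices`, ★ B2) with its Borel σ-algebra
  set Sk : AddSubgroup (Matrix (Fin 2) (Fin 2) (LocalRing L v)) :=
    skewMatrices (conjLocal L (IsCMField.complexConj L) v) (LocalSplitting.gramS (Fp L) L v 2 (gramR L e dV hdV dW hdW)) with hSkdef
  have hSk : ∀ t, t ∈ Sk ↔ (t.map (conjLocal L (IsCMField.complexConj L) v))ᵀ * LocalSplitting.gramS (Fp L) L v 2 (gramR L e dV hdV dW hdW) +
      LocalSplitting.gramS (Fp L) L v 2 (gramR L e dV hdV dW hdW) * t = 0 :=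
    fun t => (mem_skewMatrices_iff _ _ t).trans (by rw [add_comm])
  letI : MeasurableSpace ↥Sk := borel _
  haveI : BorelSpace ↥Sk := ⟨rfl⟩
  obtain ⟨ψc, hψc, -⟩ := exists_homeomorph_skew_of_carrier (F := Fp L) (E := L) (c := IsCMField.complexConj L) (v := v) (n := 2)
    (hJD := hermD_eq_map_gramD L e dV hdV dW hdW) (N' := unipDeltaLoc L e dV hdV dW hdW v) (hN' := mem_unipDeltaLoc_iff_mem_unipDeltaLocal L e dV hdV dW hdW v)
    (S := Sk) (hS := hSk)
  -- the additive Haar measure of `L⁺_v`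
  letI : MeasurableSpace (v.adicCompletion (Fp L)) := borel _
  haveI : BorelSpace (v.adicCompletion (Fp L)) := ⟨rfl⟩
  -- the character letters
  have hχur : ∀ (w : UnitaryGroup.PlacesOver L v) (x : (w.1.adicCompletion L)ˣ), Valued.v (x : w.1.adicCompletion L) = 1 → χ.localComponent w.1 x = 1 :=
    fun w x hx => hgood.chi w x ((LocalSplitting.valuation_eq_one_iff_valued L w.1 _).2 hx)
  have hχ1 : ∀ (w : UnitaryGroup.PlacesOver L v) (x : (w.1.adicCompletion L)ˣ), ‖((χ.localComponent w.1 x : ℂˣ) : ℂ)‖ = 1 := fun w x => by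
    rw [HeckeCharacter.localComponent_apply]
    exact hχu _
  -- `|2|_w = 1`, `|2|_v = 1`, `|δ ⊗ 1|_w = 1`
  have h2w : ∀ w : UnitaryGroup.PlacesOver L v, Valued.v ((2 : LocalRing L v) w) = 1 := fun w => by
    rw [Pi.ofNat_apply]
    exact (LocalSplitting.valuation_eq_one_iff_valued L w.1 _).1 (hgood.two w)
  obtain ⟨w₀⟩ := (inferInstance : Nonempty (UnitaryGroup.PlacesOver L v))
  have h2F : Valued.v (2 : v.adicCompletion (Fp L)) = 1 := by
    rw [← Liu2021.LemD1IndexedNonVacuityInertCofinite.valued_toPlace_of_isUnramifiedIn L v hunr w₀ (2 : v.adicCompletion (Fp L)), map_ofNat]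
    exact (LocalSplitting.valuation_eq_one_iff_valued L w₀.1 _).1 (hgood.two w₀)
  have h2 : ∀ w : UnitaryGroup.PlacesOver L v,
      Valued.v (toPlace v w (HeckeCharacter.uniformizer (Fp L) v : v.adicCompletion (Fp L))) ^ (0 : ℤ) ≤ Valued.v ((2 : LocalRing L v) w) := fun w => by
    rw [zpow_zero, h2w w]
  have hδu : ∀ w : UnitaryGroup.PlacesOver L v, Valued.v (algebraMap L (LocalRing L v) (imagUnit L) w) = 1 := fun w => by
    rw [Pi.algebraMap_apply]
    exact (LocalSplitting.valuation_eq_one_iff_valued L w.1 _).1 (hgood.delta w)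
  -- the skew unit `ε₁ := δ ⊗ 1`
  have hεσ : conjLocal L (IsCMField.complexConj L) v (algebraMap L (LocalRing L v) (imagUnit L)) = -algebraMap L (LocalRing L v) (imagUnit L) := by
    rw [conjLocal_algebraMap, complexConj_imagUnit, map_neg]
  have hεint : ∀ w : UnitaryGroup.PlacesOver L v, Valued.v (algebraMap L (LocalRing L v) (imagUnit L) w) ≤ 1 := fun w => (hδu w).le
  have hε : ∀ w : UnitaryGroup.PlacesOver L v,
      Valued.v (toPlace v w (HeckeCharacter.uniformizer (Fp L) v : v.adicCompletion (Fp L))) ^ (0 : ℤ) ≤ Valued.v ((2 * algebraMap L (LocalRing L v) (imagUnit L)) w) :=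
    fun w => by rw [zpow_zero, Pi.mul_apply, map_mul, h2w w, hδu w, one_mul]
  -- the index block `β = −½·(S ⊗ 1)` (§1) and the Gram letters (§1)
  have hS := fun w i j => integral_of_not_mem_kindWPlaces L e dV hdV dW hdW hv w i j
  have hSinv := fun w i j => inv_integral_of_not_mem_kindWPlaces L e dV hdV dW hdW hv w i j
  obtain ⟨hTb, hTib⟩ := gramS_letters L e dV hdV dW hdW hdV0 hdW0 v hgood (π := (HeckeCharacter.uniformizer (Fp L) v : v.adicCompletion (Fp L)))
  -- ★ B4 then the ★ glue
  rw [evalPlace_finPart_weylDelta]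
  have key := integral_unipDeltaLoc_lambdaLoc_eq_of_one_lt_re L e dV hdV dW hdW hdV0 hdW0 v hπ hπw Sk hSk ψc hψc ν MeasureTheory.Measure.addHaar χ hχ hχur
    (S : Matrix (Fin 2) (Fin 2) L) rfl (beta_skew L e dV hdV dW hdW v S) (beta_mul_betaInv L e dV hdV dW hdW v S hdet)
    (beta_integral L e dV hdV dW hdW v S hgood.two hS) (betaInv_integral L e dV hdV dW hdW v S hgood.two hSinv)
    (continuous_adeleAddCharAt (Fp L) v) hgood.psi
    (toLocalRing_algebraTrace L v (IsCMField.complexConj L) (complexConj_imagUnit L) (imagUnit_ne_zero L)) (fun r r' => map_add _ r r')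
    (algebraTrace_toLocalRing_mul L v) (continuous_algebraTrace_localRing L v) (prod_adicComponent_adeleAddChar_eq L v)
    hgood.two hgood.gram (gramR_inv_integral L e dV hdV dW hdW hdV0 hdW0 v hgood) hTb hTib hϖ0 h2F hεσ hεint hε h2 w₀ hχ1 hδu hunr hα hs
  rw [key, measureReal_setOf_mem_localInt_eq_one L e dV hdV dW hdW v ν hνK, Complex.ofReal_one, one_mul]

end PerPlace

/-! ## §3 The letter `hJ` of ★ `kindW_block_of_record`, verbatim, from the good-place kit -/

section Uniform

variable [∀ v : HeightOneSpectrum (𝓞 (Fp L)), MeasurableSpace ↥(unipDeltaLoc L e dV hdV dW hdW v)]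
  [∀ v : HeightOneSpectrum (𝓞 (Fp L)), BorelSpace ↥(unipDeltaLoc L e dV hdV dW hdW v)]

include hdV0 hdW0 in
/-- **THE `hJ` LETTER OF ★ `kindW_block_of_record` (:149–158, `n := 2`), PAID MODULO THE GOOD-PLACE KIT.**  For the carriers `νv` normalised by `hνK` (★ G1), a Hecke
character `χ` unramified off `T₀` (`hχ`, the head's own letter) and unitary (`hχu`; at the TOP `χ = μ̃ = toHeckeCharacter L λ⁻¹`, ★ `isUnitary_toHeckeCharacter`), and the
per-place kit off `T₀` — `hgood : IsGoodPlace …` (★ `eventually_isGoodPlace`: cofinitely true), `hunr` (cofinitely true), the parity letter `hα` —: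
**`∀ S h s, 2∕2 < re s → det S ≠ 0 → ∀ v ∉ kindWPlaces ↑T₀ ↑S h, ∫ conj ψ_S(ι_v y)·Λ_{s,v}((w_Δ)_v y) d(νv v)(y) = (1 − q_v^{−(2s+1)})(1 − ε(ϖ_v) q_v^{−(2s+2)})`** (§2 at each `v`;
`v ∉ U(S,h) ⇒ v ∉ T₀`, ★ `not_mem_of_not_mem_kindWPlaces`). [cite: Liu2011, §2A (2-10)] [cite: Shimura1997, §18.1 (18.4)] [cite: KudlaRallis1994, §1] [cite: GelbartRogawski1991, §3.1 (3.1.3)] -/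
theorem hJ_of_isGoodPlace (T₀ : Finset (HeightOneSpectrum (𝓞 (Fp L))))
    (νv : ∀ v : HeightOneSpectrum (𝓞 (Fp L)), Measure ↥(unipDeltaLoc L e dV hdV dW hdW v)) [∀ v, (νv v).IsHaarMeasure]
    (hνK : ∀ v, νv v (((inH (fun v => UnitaryGroup.localInt L (IsCMField.complexConj L) (2 + 2) (hermD L e dV hdV dW hdW) v)
      (fun v => unipDeltaLoc L e dV hdV dW hdW v) v) : Subgroup ↥(unipDeltaLoc L e dV hdV dW hdW v)) : Set ↥(unipDeltaLoc L e dV hdV dW hdW v)) = 1)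
    {χ : HeckeCharacter L} (hχ : ∀ v, v ∉ T₀ → ∀ w' : UnitaryGroup.PlacesOver L v, χ.IsUnramifiedAt w'.1) (hχu : χ.IsUnitary)
    (hgood : ∀ v, v ∉ T₀ → LocalSplitting.IsGoodPlace (Fp L) L (imagUnit L) v 2 (gramR L e dV hdV dW hdW) (fun w => χ.localComponent w.1))
    (hunr : ∀ v, v ∉ T₀ → Algebra.IsUnramifiedIn (𝓞 L) v.asIdeal)
    (hα : ∀ v, v ∉ T₀ → (((∏ w : UnitaryGroup.PlacesOver L v, χ.localComponent w.1
        (Units.mk0 (toPlace v w (HeckeCharacter.uniformizer (Fp L) v : v.adicCompletion (Fp L)))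
          ((map_ne_zero (toPlace v w)).2 (HeckeCharacter.uniformizer (Fp L) v).ne_zero))) : ℂˣ) : ℂ) = (quadraticHeckeCharCM L).valueAtUniformizer v) :
    ∀ (S : skewMatrices ((IsCMField.complexConj L : L ≃ₐ[Fp L] L) : L →+* L) ((gramR L e dV hdV dW hdW).map (algebraMap (Fp L) L))) (h : HA L e dV hdV dW hdW) (s : ℂ),
      ((2 : ℕ) : ℝ) / 2 < s.re → (S : Matrix (Fin 2) (Fin 2) L).det ≠ 0 →
      ∀ v, v ∉ kindWPlaces L e dV hdV dW hdW (T₀ : Set (HeightOneSpectrum (𝓞 (Fp L)))) (S : Matrix (Fin 2) (Fin 2) L) h →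
        ∫ y, conj (unipDeltaChar L e dV hdV dW hdW (S : Matrix (Fin 2) (Fin 2) L)
              (locToAdelic L e dV hdV dW hdW v (y : UnitaryGroup.localPi L (IsCMField.complexConj L) (2 + 2) (hermD L e dV hdV dW hdW) v)) : ℂ) *
            LambdaLoc L e dV hdV dW hdW v χ s
              (UnitaryGroup.evalPlace (Fp L) L (IsCMField.complexConj L) (2 + 2) (hermD L e dV hdV dW hdW) v
                  (UnitaryGroup.finPart (Fp L) L (IsCMField.complexConj L) (2 + 2) (hermD L e dV hdV dW hdW) (SiegelDoubled.weylDelta L e dV hdV dW hdW)) *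
                (y : UnitaryGroup.localPi L (IsCMField.complexConj L) (2 + 2) (hermD L e dV hdV dW hdW) v)) ∂(νv v) =
          (1 - (v.residueCard : ℂ) ^ (-(2 * s + 1))) * (1 - (quadraticHeckeCharCM L).valueAtUniformizer v * (v.residueCard : ℂ) ^ (-(2 * s + 2))) := by
  intro S h s hs hdet v hv
  have hvT : v ∉ T₀ := fun h' => not_mem_of_not_mem_kindWPlaces L e dV hdV dW hdW hv (Finset.mem_coe.2 h')
  have hs' : 1 < s.re := by norm_num at hs; exact hs
  exact integral_conj_unipDeltaChar_mul_lambdaLoc_weylDelta_eq_of_isGoodPlace L e dV hdV dW hdW hdV0 hdW0 v (hχ v hvT) hχu (hgood v hvT) (hunr v hvT) (hα v hvT)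
    (νv v) (hνK v) S h hdet hv hs'

end Uniform

end Summit.HodgeConjecture.HodgeConjecture.Cruxes.HLiu418.K2LiuKindWGoodPlaceFactor

end
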